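import Summits.MatrixMultiplication.MatrixMultiplication.Theorems.TetraDiagonalCore
import Literature.Computability.AlgebraicComplexity.RectangularExponentAlpha
import HarnessLib

/-!
# TetraDiagonalLadder — the exponent `ω_diag(ε)` of the thin-diagonal family and the ladder under `TetraFlat`

(decomp-mm lens 6, generation 19; kernel A2 of NODE-g19, continuing `TetraDiagonalCore`. Cut of record
UNCHANGED; theorems below the attacked leaf `TetraFlat` (item 33477), no item.)

With `d = ⌈n^ε⌉` the thin-diagonal tetrahedra `Z_n^{(⌈n^ε⌉)}` (`diagTetra`, kernel A1) have the exponent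
`ω_diag(ε) = inf{β : R₄(Z_n^{(⌈n^ε⌉)}) = O(n^β)}` (`omegaDiag`; CVZ19 Def. 1.1.13/1.1.25 with a
non-uniform dimension function), `ω_diag(1) = ω(K₄)` (`omegaDiag_one`).

WHAT IS PROVED (every field unless marked ℂ; sorry-free, no new axiom / instance / notation / Prop-def):
* §4 EXPONENT BRACKET for `ε ≤ 1`:  `4 ≤ ω(2,ε,2) ≤ ω_diag(ε) ≤ ω(K₄) ≤ 2ω` (`omegaDiag_bracket`;
  restriction for the upper, grouping `{0,1}|2|3` + the information bound for the lower),
  `ω_diag` monotone in `ε` (`omegaDiag_mono`), `ω_diag(1) = ω(K₄)`.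
* §5 THE DIAGONAL LADDER: `TetraFlat ⟹ ω_diag(ε) ≤ 4` for every `ε ≤ 1`
  (`omegaDiag_le_four_of_tetraFlat`; `tetraFlat_iff_omegaDiag_one_le_four : TetraFlat ⟺ ω_diag(1) ≤ 4`),
  every rung is necessary for the summit (`omegaDiag_eq_four_of_matrixMultiplication`, ℂ), and each rung
  has the classical shadow `ω_diag(ε) ≤ 4 ⟹ ω(2,ε,2) = 4 ⟹ ω(1,ε/2,1) = 2 ⟹ ε/2 ≤ α`
  (`half_eps_le_dualExponentAlpha_of_omegaDiag_le_four`). At `ε = 1` this is the g13 shadow `α ≥ 1/2`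
  (`TetrahedronTensorRectangular`); the rungs weaken as `ε ↓ 0`, and their shadows `α ≥ ε/2` stay
  inside the record `α > 0.321334` exactly for `ε ≤ 0.642668`: the rungs `ω_diag(ε) ≤ 4` with
  `α < ε ≤ 2α` are the first statements below `TetraFlat` with NO beyond-record classical shadow
  (for `ε ≤ α` the rung follows from the half-triangle cover `ω_diag(ε) ≤ 2ω(1,ε,1)`, not typed here).
Sources: [corpus:paper-arxiv-1609.07476 Def. 1.1.13, Prop. 1.1.26] · tree `TetrahedronTensorRectangular`,
`Literature…RectangularExponent{,Alpha,Homogeneity,InformationBound}`.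
-/

noncomputable section

set_option linter.dupNamespace false

open scoped BigOperators
open Filter Asymptotics
open Literature.Computability.AlgebraicComplexity
open Summit.MatrixMultiplication.MatrixMultiplication.Theorems.TetrahedronTensor
open Summit.MatrixMultiplication.MatrixMultiplication.Theses.TetrahedronCarving

namespace Summit.MatrixMultiplication.MatrixMultiplication.Theorems.TetraDiagonal

/-! ## §4 The exponent `ω_diag(ε)` and its bracket -/

section Exponent

variable (F : Type) [Field F]

/-- Every admissible exponent of `T(K₄)` is admissible for every thin-diagonal family (restriction). -/
theorem tetraAdmissibleExponents_subset_diag (ε : ℝ) :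
    tetraAdmissibleExponents F ⊆ diagAdmissibleExponents F ε := by
  intro β hβ
  refine IsBigO.trans ?_ hβ
  refine IsBigO.of_bound 1 (Eventually.of_forall fun n => ?_)
  rw [one_mul, Real.norm_of_nonneg (Nat.cast_nonneg _), Real.norm_of_nonneg (Nat.cast_nonneg _)]
  exact_mod_cast tensorRankD_diagTetra_le_tetra (F := F) n (rectDim n ε)

/-- Every admissible exponent of the `ε`-thin family (`ε ≤ 1`) is admissible for `⟨n², ⌈n^ε⌉, n²⟩`
(grouping). -/
theorem diagAdmissibleExponents_subset_rect {ε : ℝ} (hε1 : ε ≤ 1) :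
    diagAdmissibleExponents F ε ⊆ rectAdmissibleExponents F 2 ε 2 := by
  intro β hβ
  refine IsBigO.trans ?_ hβ
  refine IsBigO.of_bound 1 ?_
  filter_upwards [eventually_ge_atTop 1] with n hn
  rw [one_mul, Real.norm_of_nonneg (Nat.cast_nonneg _), Real.norm_of_nonneg (Nat.cast_nonneg _)]
  haveI : NeZero n := ⟨by omega⟩
  have h2 : rectDim n 2 = n * n := by
    rw [show (2 : ℝ) = ((2 : ℕ) : ℝ) by norm_num, rectDim_natCast, pow_two]
  rw [tensorRank_matMulTensor_congr F h2 rfl h2]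
  have hd : 0 < rectDim n ε := one_le_rectDim hn ε
  have hdN : rectDim n ε ≤ n := (rectDim_mono hn hε1).trans (rectDim_one n).le
  exact_mod_cast tensorRank_matMulTensor_le_tensorRankD_diagTetra (F := F) hd hdN

/-- Thinner diagonals are cheaper: `ε ≤ ε'` ⟹ admissible exponents of `ε'` are admissible for `ε`. -/
theorem diagAdmissibleExponents_anti {ε ε' : ℝ} (h : ε ≤ ε') :
    diagAdmissibleExponents F ε' ⊆ diagAdmissibleExponents F ε := by
  intro β hβ
  refine IsBigO.trans ?_ hβ
  refine IsBigO.of_bound 1 ?_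
  filter_upwards [eventually_ge_atTop 1] with n hn
  rw [one_mul, Real.norm_of_nonneg (Nat.cast_nonneg _), Real.norm_of_nonneg (Nat.cast_nonneg _)]
  exact_mod_cast tensorRankD_diagTetra_mono (F := F) (n := n) (rectDim_mono hn h)

/-- `6` is admissible for every thin-diagonal family. -/
theorem diagAdmissibleExponents_nonempty (ε : ℝ) : (diagAdmissibleExponents F ε).Nonempty :=
  ⟨6, tetraAdmissibleExponents_subset_diag F ε (six_mem_tetraAdmissibleExponents F)⟩

/-- The admissible exponents of a thin-diagonal family (`ε ≤ 1`) are bounded below. -/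
theorem diagAdmissibleExponents_bddBelow {ε : ℝ} (hε1 : ε ≤ 1) :
    BddBelow (diagAdmissibleExponents F ε) :=
  (rectAdmissibleExponents_bddBelow F 2 ε 2).mono (diagAdmissibleExponents_subset_rect F hε1)

/-- **`ω_diag(ε) ≤ ω(K₄)`** (`ε ≤ 1`; restriction). [folklore] -/
theorem omegaDiag_le_omegaTetra {ε : ℝ} (hε1 : ε ≤ 1) : omegaDiag F ε ≤ omegaTetra F :=
  csInf_le_csInf (diagAdmissibleExponents_bddBelow F hε1) (tetraAdmissibleExponents_nonempty F)
    (tetraAdmissibleExponents_subset_diag F ε)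

/-- **`ω(2, ε, 2) ≤ ω_diag(ε)`** (`ε ≤ 1`; grouping `{0,1} | 2 | 3`). [folklore] -/
theorem omegaRect_two_mid_two_le_omegaDiag {ε : ℝ} (hε1 : ε ≤ 1) :
    omegaRect F 2 ε 2 ≤ omegaDiag F ε :=
  csInf_le_csInf (rectAdmissibleExponents_bddBelow F 2 ε 2) (diagAdmissibleExponents_nonempty F ε)
    (diagAdmissibleExponents_subset_rect F hε1)

/-- **`4 ≤ ω_diag(ε)`** (`ε ≤ 1`): the `{01}|{23}`-type flattening, here through the information bound
`2 + 2 ≤ ω(2,ε,2)`. [folklore] -/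
theorem four_le_omegaDiag {ε : ℝ} (hε1 : ε ≤ 1) : 4 ≤ omegaDiag F ε := by
  have h := add_le_omegaRect₁₃ F 2 ε 2
  have h' := omegaRect_two_mid_two_le_omegaDiag F hε1
  norm_num at h
  linarith

/-- **`ω_diag(1) = ω(K₄)`**: the top of the family is the tetrahedron exponent. -/
theorem omegaDiag_one : omegaDiag F 1 = omegaTetra F := by
  unfold omegaDiag omegaTetra diagAdmissibleExponents tetraAdmissibleExponents
  simp only [rectDim_one, diagTetra_self]

/-- **Monotone in `ε`**: `ω_diag(ε) ≤ ω_diag(ε')` for `ε ≤ ε' ≤ 1`. [folklore] -/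
theorem omegaDiag_mono {ε ε' : ℝ} (h : ε ≤ ε') (hε'1 : ε' ≤ 1) : omegaDiag F ε ≤ omegaDiag F ε' :=
  csInf_le_csInf (diagAdmissibleExponents_bddBelow F (h.trans hε'1))
    (diagAdmissibleExponents_nonempty F ε') (diagAdmissibleExponents_anti F h)

/-- **The bracket** `4 ≤ ω(2,ε,2) ≤ ω_diag(ε) ≤ ω(K₄) ≤ 2ω` for `ε ≤ 1`. [folklore] -/
theorem omegaDiag_bracket {ε : ℝ} (hε1 : ε ≤ 1) :
    4 ≤ omegaRect F 2 ε 2 ∧ omegaRect F 2 ε 2 ≤ omegaDiag F ε ∧ omegaDiag F ε ≤ omegaTetra F ∧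
      omegaTetra F ≤ 2 * omega F := by
  refine ⟨?_, omegaRect_two_mid_two_le_omegaDiag F hε1, omegaDiag_le_omegaTetra F hε1,
    omegaTetra_le_two_mul_omega F⟩
  have h := add_le_omegaRect₁₃ F 2 ε 2
  norm_num at h
  exact h

end Exponent

/-! ## §5 The diagonal ladder under `TetraFlat` and the classical shadow of each rung -/

section Ladder

variable (F : Type) [Field F]

/-- **Rungs below the attacked leaf**: `ω(K₄) ≤ 4 ⟹ ω_diag(ε) ≤ 4` for every `ε ≤ 1`. [folklore] -/
theorem omegaDiag_le_four_of_omegaTetra_le_four (h : omegaTetra F ≤ 4) {ε : ℝ} (hε1 : ε ≤ 1) :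
    omegaDiag F ε ≤ 4 :=
  (omegaDiag_le_omegaTetra F hε1).trans h

/-- A flat rung is exactly flat: `ω_diag(ε) ≤ 4 ⟺ ω_diag(ε) = 4` (`ε ≤ 1`). [folklore] -/
theorem omegaDiag_le_four_iff {ε : ℝ} (hε1 : ε ≤ 1) : omegaDiag F ε ≤ 4 ↔ omegaDiag F ε = 4 :=
  ⟨fun h => le_antisymm h (four_le_omegaDiag F hε1), fun h => h.le⟩

/-- **Shadow of a rung, rectangular form**: `ω_diag(ε) ≤ 4 ⟹ ω(2, ε, 2) = 4`. [folklore] -/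
theorem omegaRect_two_mid_two_eq_four_of_omegaDiag_le_four {ε : ℝ} (hε1 : ε ≤ 1)
    (h : omegaDiag F ε ≤ 4) : omegaRect F 2 ε 2 = 4 := by
  refine le_antisymm ((omegaRect_two_mid_two_le_omegaDiag F hε1).trans h) ?_
  have h4 := add_le_omegaRect₁₃ F 2 ε 2
  norm_num at h4
  exact h4

/-- **Shadow of a rung, dual-exponent form**: `ω_diag(ε) ≤ 4 ⟹ ω(1, ε/2, 1) = 2` (homogeneity
`ω(2,ε,2) = 2·ω(1,ε/2,1)`). [folklore] -/
theorem omegaRect_one_halfEps_one_eq_two_of_omegaDiag_le_four {ε : ℝ} (hε0 : 0 ≤ ε) (hε1 : ε ≤ 1)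
    (h : omegaDiag F ε ≤ 4) : omegaRect F 1 (ε / 2) 1 = 2 := by
  have hs := omegaRect_smul (K := F) (t := 2) (by norm_num) (a := 1) (b := ε / 2) (c := 1)
    (by norm_num) (by linarith) (by norm_num)
  have h2 : ((2 : ℕ) : ℝ) * (ε / 2) = ε := by push_cast; ring
  have h1 : ((2 : ℕ) : ℝ) * 1 = 2 := by norm_num
  rw [h2, h1] at hs
  have h4 := omegaRect_two_mid_two_eq_four_of_omegaDiag_le_four F hε1 h
  rw [h4] at hs
  have h22 : ((2 : ℕ) : ℝ) = 2 := by norm_num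
  rw [h22] at hs
  linarith

/-- **Shadow of a rung on the dual exponent**: `ω_diag(ε) ≤ 4 ⟹ ε/2 ≤ α` (`0 ≤ ε ≤ 1`). At `ε = 1`
this is `TetraFlat ⟹ α ≥ 1/2`; the shadow stays inside the record `α > 0.321334` iff `ε ≤ 0.642668`.
[folklore] -/
theorem half_eps_le_dualExponentAlpha_of_omegaDiag_le_four {ε : ℝ} (hε0 : 0 ≤ ε) (hε1 : ε ≤ 1)
    (h : omegaDiag F ε ≤ 4) : ε / 2 ≤ dualExponentAlpha F :=
  le_dualExponentAlpha (K := F) ⟨by linarith, by linarith⟩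
    (omegaRect_one_halfEps_one_eq_two_of_omegaDiag_le_four F hε0 hε1 h)

/-- **`TetraFlat ⟺ ω_diag(1) ≤ 4`**: the attacked leaf is the top rung of the diagonal ladder. -/
theorem tetraFlat_iff_omegaDiag_one_le_four : TetraFlat ↔ omegaDiag ℂ 1 ≤ 4 := by
  unfold TetraFlat
  rw [omegaDiag_one]

/-- **The ladder under the item**: `TetraFlat ⟹ ω_diag(ε) ≤ 4` for every `ε ≤ 1` (item 33477 implies
every rung; the rungs weaken as `ε ↓ 0`). -/
theorem omegaDiag_le_four_of_tetraFlat (h : TetraFlat) {ε : ℝ} (hε1 : ε ≤ 1) : omegaDiag ℂ ε ≤ 4 :=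
  omegaDiag_le_four_of_omegaTetra_le_four ℂ h hε1

/-- Every rung is NECESSARY for the summit: `ω = 2 ⟹ ω_diag(ε) = 4` (`ε ≤ 1`). -/
theorem omegaDiag_eq_four_of_matrixMultiplication (hS : _root_.MatrixMultiplication) {ε : ℝ}
    (hε1 : ε ≤ 1) : omegaDiag ℂ ε = 4 :=
  (omegaDiag_le_four_iff ℂ hε1).1
    (omegaDiag_le_four_of_tetraFlat (omegaTetra_le_four_of_matrixMultiplication hS) hε1)

/-- **Rung ⟹ dual-exponent shadow, item form**: `TetraFlat ⟹ ε/2 ≤ α` for every `ε ∈ [0,1]`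
(sup over `ε`: `α ≥ 1/2`, the g13 shadow). -/
theorem half_eps_le_dualExponentAlpha_of_tetraFlat (h : TetraFlat) {ε : ℝ} (hε0 : 0 ≤ ε)
    (hε1 : ε ≤ 1) : ε / 2 ≤ dualExponentAlpha ℂ :=
  half_eps_le_dualExponentAlpha_of_omegaDiag_le_four ℂ hε0 hε1 (omegaDiag_le_four_of_tetraFlat h hε1)

end Ladder

end Summit.MatrixMultiplication.MatrixMultiplication.Theorems.TetraDiagonal

end
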